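import Literature.Barriers.ValiantsHypothesis.BDGIL24CentralCharacterSeparation
import Literature.RepresentationTheory.ClassicalInvariants.PowerSumBasicInvariants
import HarnessLib

/-!
# [BDGIL24, Thm. 4.13] for `gl_k`: the centre `Z(gl_k)` is the polynomial algebra
# `ℂ[C_1, …, C_k]` in the Casimir elements (8), algebraically independent, of lengths `1, …, k`
# — PROVED (`BergEtAl2024.thm_4_13`)

[BDGIL24] = M. van den Berg, P. Dutta, F. Gesmundo, C. Ikenmeyer, V. Lysikov, *Algebraic
metacomplexity and representation theory*, arXiv:2411.03444, §4.4 (p.20–21, PDF pp.21–22; held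
text paper:arxiv-2411.03444 p0021.txt:L48–L60, p0022.txt:L1–L6):

> "**Theorem 4.13** (Harish–Chandra isomorphism, [Hum78, Ch. 23]; [Ber81]). Let `𝔤` be a reductive
> algebra and let `𝔥` be a Cartan subalgebra. The center `Z(𝔤)` of the universal enveloping algebra
> is isomorphic to the algebra of invariants `U(𝔥)^{W_𝔤}`. Moreover, if `dim 𝔥 = k`, there exist
> algebraically independent `C_1, …, C_k ∈ U(𝔤)` such that `Z(𝔤) = ℂ[C_1, …, C_k]`. The lengths of
> these elements coincide with the degrees of the fundamental invariants of `U(𝔥)^{W_𝔤}`. […]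
> Consider the case of `gl_k` […] `U(𝔥)^{W_{gl_k}}` is […] the classical ring of symmetric polynomials
> in `k` variables. It is generated, for instance, by the elementary symmetric polynomials, which
> have degrees `1, …, k`. These numbers give lengths of Casimir elements generating the center
> `Z(𝔤)`. There are several constructions of Casimir elements, one possible choice being
> `C_p := Σ_{i_1,…,i_p} E_{i_1 i_2} E_{i_2 i_3} ⋯ E_{i_p i_1}` with `1 ≤ p ≤ k`. (8)"

## What is typed and proved (the `gl_k` case, as printed after the general statement)

In the block matrix model `U(T → gl_n)` of the tree's Harish-Chandra core (`HarishChandraCore`,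
namespace `HCCore`; the Casimir elements (8) are `HCCore.casimir n τ p = tr(𝔼_τ^p)`, the algebra
map `G ↦ G(C_{τ,p+1})` is `HCCore.zOfPoly`):

* the first clause — `Z(𝔤) ≅ U(𝔥)^W` = symmetric polynomials — IS the tree's Harish-Chandra
  isomorphism `HarishChandraHomGL.complexified_injective_and_range_eq` (with
  `symmetricSubalgebraGL_eq_blockSymmetricSubalgebra`); it is CITED, not restated;
* `exists_zOfPoly_fil_gamma_eq` — Harish-Chandra surjectivity with the witness kept as a
  POLYNOMIAL IN THE CASIMIR ELEMENTS of bounded length (explicit-witness re-run of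
  `exists_center_fil_gamma_eq`), for any block type `T` and any `γ'` with the highest weight
  property and symmetric values;
* `zOfPoly_surjective_of_hasHWProperty` — hence, when such a `γ'` is injective, every central
  element is a polynomial in the Casimir elements: **`Z(gl_n^T) = ℂ[C_{τ,p}]`**;
* `restrictDiag_symb_zOfPoly`, `zOfPoly_injective_of_blockPsumAeval_injective` — the top symbol of
  `G(C)` restricted to the diagonal is the block power-sum image of the top weighted component of
  `G`; so the Casimir elements are ALGEBRAICALLY INDEPENDENT as soon as the block power sums are
  (`blockPsumAeval` injective), which for one block is the tree's `algebraicIndependent_psum`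
  (`blockPsumAeval_injective_of_subsingleton`);
* `casimir_not_mem_fil` — **the length of `C_p` is exactly `p`** (`C_p ∈ U(𝔤)_{≤p}` is the tree's
  `HCCore.casimir_mem_fil`; `C_p ∉ U(𝔤)_{≤m}` for `m < p` because its `p`-th symbol restricts to the
  power sum `p_p ≠ 0`);
* **`thm_4_13`** — the printed `gl_k` statement at the index type `T₀ = (ℝ →ₐ[ℝ] ℂ)` (ONE block —
  `Subsingleton`, Mathlib `Algebra.subsingleton_id` — where the tree's Harish-Chandra isomorphism
  lives, as in `cor_5_6_length`): the Casimir elements `C_{τ,p+1}`, `p < k`, are algebraically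
  independent, generate the centre (`Subalgebra.center = Algebra.adjoin (range C)`), and `C_{p+1}`
  has length exactly `p + 1`.

Honest framing: representation-theoretic bookkeeping; nothing here bears on `VP ≠ VNP`.

## References
* [BergEtAl2024] arXiv:2411.03444, §4.3 (length), §4.4 Thm. 4.13 and eq. (8) (p.20–21).
* [Humphreys1972] J. E. Humphreys, *Introduction to Lie Algebras and Representation Theory*,
  GTM 9, §23.3 (as vendored in `HarishChandraCore`).
* [GoodmanWallachGTM255] §5.1.3 Exercise 4 (power sums algebraically independent; tree
  `PowerSumBasicInvariants`).
-/

noncomputable section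

-- Mathlib idiom: the commutator bracket on an associative algebra (`T → Matrix (Fin n) (Fin n) ℂ`),
-- as in the imported `BDGIL24CentralCharacters` / `HarishChandraCore`
attribute [local instance 100] LieRing.ofAssociativeRing

open MvPolynomial UniversalEnvelopingAlgebra
open scoped BigOperators

namespace Literature.Barriers.ValiantsHypothesis

namespace BergEtAl2024

open Literature.NumberTheory.Automorphic Literature.NumberTheory.Automorphic.HCCore
open Literature.RingTheory.MvPolynomial.BlockSymmetric Literature.Algebra.Lie.PBW
open Literature.Algebra.Lie.ChevalleyGL

attribute [local instance] Literature.NumberTheory.Automorphic.HCCore.idxLinearOrder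

/-! ### Harish-Chandra surjectivity with the witness a polynomial in the Casimir elements -/

section Generation

variable {T : Type*} [Fintype T] [DecidableEq T] {n : ℕ}

/-- **Every block-symmetric polynomial of degree `≤ d` is the Harish-Chandra image of a POLYNOMIAL
IN THE CASIMIR ELEMENTS `G(C_{τ,p+1})` of length `≤ d`** (explicit-witness form of
`exists_center_fil_gamma_eq`: the induction on the degree peels off the top homogeneous component
with `HCCore.zOfPoly` of a weighted homogeneous `G`, `gamma_zOfPoly_top`).
[cite: BergEtAl2024, Thm. 4.13, p.20 (PDF p.21)] locator: paper:arxiv-2411.03444 p0021.txt:L48–L53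
[cite: Humphreys1972, §23.3] -/
theorem exists_zOfPoly_fil_gamma_eq {c : T × Fin n → ℂ}
    {γ' : Subalgebra.center ℂ (UniversalEnvelopingAlgebra ℂ (𝔤 T n)) →ₐ[ℂ] MvPolynomial (T × Fin n) ℂ}
    (hγ : HasHWProperty c γ') (hsym : ∀ z, γ' z ∈ blockSymmetricSubalgebra T n ℂ) (d : ℕ) :
    ∀ f ∈ blockSymmetricSubalgebra T n ℂ, f.totalDegree ≤ d →
      ∃ G : MvPolynomial (T × Fin n) ℂ,
        ((zOfPoly T n G : Subalgebra.center ℂ (UniversalEnvelopingAlgebra ℂ (𝔤 T n))) :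
            UniversalEnvelopingAlgebra ℂ (𝔤 T n)) ∈ fil (stdB T n) d ∧
          γ' (zOfPoly T n G) = f := by
  induction d with
  | zero =>
    intro f hf hd
    obtain ⟨G, hG, hGf⟩ := exists_isWeightedHomogeneous_blockPsumAeval_eq T n hf
      ((totalDegree_zero_iff_isHomogeneous _).mp (Nat.le_zero.mp hd))
    obtain ⟨hz1, hz2⟩ := gamma_zOfPoly_top hγ hG
    refine ⟨G, (zOfPoly_mem_fil_and_symb hG).1, ?_⟩
    rw [← homogeneousComponent_eq_self ((totalDegree_zero_iff_isHomogeneous _).mp (Nat.le_zero.mp hz1)),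
      hz2, hGf]
  | succ d ih =>
    intro f hf hd
    have hfd := homogeneousComponent_mem_blockSymmetricSubalgebra hf (d + 1)
    obtain ⟨G, hG, hGf⟩ := exists_isWeightedHomogeneous_blockPsumAeval_eq T n hfd
      (homogeneousComponent_isHomogeneous (d + 1) f)
    obtain ⟨hz1, hz2⟩ := gamma_zOfPoly_top hγ hG
    have hg : f - γ' (zOfPoly T n G) ∈ blockSymmetricSubalgebra T n ℂ := Subalgebra.sub_mem _ hf (hsym _)
    have hgd : (f - γ' (zOfPoly T n G)).totalDegree ≤ d := by
      refine totalDegree_le_of_homogeneousComponent_eq_zero ?_ ?_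
      · exact (totalDegree_sub _ _).trans (max_le hd hz1)
      · rw [map_sub, hz2, hGf, sub_self]
    obtain ⟨G', hG'f, hG'⟩ := ih _ hg hgd
    refine ⟨G' + G, ?_, ?_⟩
    · rw [map_add, Subalgebra.coe_add]
      exact Submodule.add_mem _ (fil_mono (stdB T n) (Nat.le_succ d) hG'f) (zOfPoly_mem_fil_and_symb hG).1
    · rw [map_add, map_add, hG', sub_add_cancel]

/-- **`Z(gl_n^T) = ℂ[C_{τ,p}]`**: if a `γ'` with the highest weight property and symmetric values is
injective on the centre (Harish-Chandra's theorem), then every central element of `U(gl_n^T)` is a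
polynomial in the Casimir elements `C_{τ,p+1} = tr(𝔼_τ^{p+1})` — `HCCore.zOfPoly` is onto the centre
("there exist […] `C_1, …, C_k ∈ U(𝔤)` such that `Z(𝔤) = ℂ[C_1, …, C_k]`").
[cite: BergEtAl2024, Thm. 4.13, p.20 (PDF p.21)] locator: paper:arxiv-2411.03444 p0021.txt:L48–L53
[cite: Humphreys1972, §23.3] -/
theorem zOfPoly_surjective_of_hasHWProperty {c : T × Fin n → ℂ}
    {γ' : Subalgebra.center ℂ (UniversalEnvelopingAlgebra ℂ (𝔤 T n)) →ₐ[ℂ] MvPolynomial (T × Fin n) ℂ}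
    (hγ : HasHWProperty c γ') (hsym : ∀ z, γ' z ∈ blockSymmetricSubalgebra T n ℂ)
    (hinj : Function.Injective γ') : Function.Surjective (zOfPoly T n) := by
  intro z
  obtain ⟨G, -, hG⟩ := exists_zOfPoly_fil_gamma_eq hγ hsym (γ' z).totalDegree _ (hsym z) le_rfl
  exact ⟨G, hinj hG⟩

end Generation

/-! ### Algebraic independence of the Casimir elements: top symbols are block power sums -/

section Independence

variable {T : Type*} [Fintype T] [DecidableEq T] {n : ℕ}

/-- **The top symbol of a polynomial in the Casimir elements.** If every monomial of `G` has weight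
`≤ d` (`w(Y_{τ,p}) = p + 1`), then `G(C) ∈ U(𝔤)_{≤d}` and the restriction to the diagonal of its
`d`-th symbol is the block power-sum image `G_d(p_{p+1}(x_{τ,·}))` of the weight-`d` component
`G_d` of `G` (monomial by monomial: `HCCore.zOfPoly_monomial`; lower-weight monomials have vanishing
`d`-th symbol, `symb_eq_zero_of_mem_fil`). [cite: Humphreys1972, §23.3]
[cite: BergEtAl2024, Thm. 4.13, p.20 (PDF p.21)] -/
theorem restrictDiag_symb_zOfPoly (G : MvPolynomial (T × Fin n) ℂ) {d : ℕ}
    (hd : ∀ m ∈ G.support, Finsupp.weight (blockWeight T n) m ≤ d) :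
    ((zOfPoly T n G : Subalgebra.center ℂ (UniversalEnvelopingAlgebra ℂ (𝔤 T n))) :
        UniversalEnvelopingAlgebra ℂ (𝔤 T n)) ∈ fil (stdB T n) d ∧
      restrictDiag T n ℂ (symb (stdB T n) d
        ((zOfPoly T n G : Subalgebra.center ℂ (UniversalEnvelopingAlgebra ℂ (𝔤 T n))) :
          UniversalEnvelopingAlgebra ℂ (𝔤 T n))) =
        blockPsumAeval T n ℂ (weightedHomogeneousComponent (blockWeight T n) d G) := by
  classical
  have hG' : ((zOfPoly T n G : Subalgebra.center ℂ (UniversalEnvelopingAlgebra ℂ (𝔤 T n))) :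
      UniversalEnvelopingAlgebra ℂ (𝔤 T n)) =
      ∑ m ∈ G.support, coeff m G • ((zOfPoly T n (monomial m 1) :
        Subalgebra.center ℂ (UniversalEnvelopingAlgebra ℂ (𝔤 T n))) : UniversalEnvelopingAlgebra ℂ (𝔤 T n)) := by
    conv_lhs => rw [← G.support_sum_monomial_coeff, map_sum]
    rw [AddSubmonoidClass.coe_finsetSum]
    refine Finset.sum_congr rfl fun m _ => ?_
    rw [show monomial m (coeff m G) = coeff m G • monomial m 1 by
      rw [smul_monomial, smul_eq_mul, mul_one], map_smul, Subalgebra.coe_smul]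
  constructor
  · rw [hG']
    refine Submodule.sum_mem _ fun m hm => Submodule.smul_mem _ _ ?_
    exact fil_mono (stdB T n) (hd m hm) (zOfPoly_monomial m).1
  · rw [hG', map_sum, map_sum, weightedHomogeneousComponent_apply, map_sum, Finset.sum_filter]
    refine Finset.sum_congr rfl fun m hm => ?_
    rw [map_smul, map_smul]
    by_cases hmd : Finsupp.weight (blockWeight T n) m = d
    · rw [if_pos hmd, ← hmd, (zOfPoly_monomial m).2,
        show monomial m (coeff m G) = coeff m G • monomial m 1 by
          rw [smul_monomial, smul_eq_mul, mul_one], map_smul]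
    · rw [if_neg hmd, symb_eq_zero_of_mem_fil (stdB T n)
        (lt_of_le_of_ne (hd m hm) hmd) (zOfPoly_monomial m).1, map_zero, smul_zero]

/-- **The Casimir elements are algebraically independent as soon as the block power sums are**:
if `blockPsumAeval` (`Y_{τ,p} ↦ p_{p+1}(x_{τ,·})`) is injective, so is `G ↦ G(C_{τ,p+1})`
(`HCCore.zOfPoly`): a nonzero `G` with `G(C) = 0` would have top weighted component `G_d ≠ 0` with
`G_d(p) = 0` (`restrictDiag_symb_zOfPoly`). [cite: BergEtAl2024, Thm. 4.13, p.20 (PDF p.21)] locator: paper:arxiv-2411.03444 p0021.txt:L48–L51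
[cite: Humphreys1972, §23.3] -/
theorem zOfPoly_injective_of_blockPsumAeval_injective
    (hinj : Function.Injective (blockPsumAeval T n ℂ)) : Function.Injective (zOfPoly T n) := by
  classical
  refine (injective_iff_map_eq_zero (zOfPoly T n)).2 fun G hG => ?_
  by_contra hG0
  -- the top weight `d` of `G` is attained at some monomial `m₀`
  have hne : G.support.Nonempty := MvPolynomial.support_nonempty.2 hG0
  obtain ⟨m₀, hm₀, hm₀d⟩ := Finset.exists_mem_eq_sup G.support hne (Finsupp.weight (blockWeight T n))
  set d := G.support.sup (Finsupp.weight (blockWeight T n)) with hdd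
  have hle : ∀ m ∈ G.support, Finsupp.weight (blockWeight T n) m ≤ d := fun m hm =>
    Finset.le_sup (f := Finsupp.weight (blockWeight T n)) hm
  have htop := (restrictDiag_symb_zOfPoly G hle).2
  rw [hG, ZeroMemClass.coe_zero, map_zero, map_zero] at htop
  -- so the weight-`d` component of `G` is killed by `blockPsumAeval`, hence is `0`
  have hGd : weightedHomogeneousComponent (blockWeight T n) d G = 0 :=
    hinj (by rw [← htop, map_zero])
  have hcoef := congr_arg (coeff m₀) hGd
  rw [coeff_weightedHomogeneousComponent, if_pos hm₀d.symm, coeff_zero] at hcoef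
  exact (mem_support_iff.1 hm₀) hcoef

omit [Fintype T] [DecidableEq T] in
/-- **For ONE block the block power sums are algebraically independent** (`blockPsumAeval`
injective): transport along `T × Fin n ≃ Fin n` of the tree's `algebraicIndependent_psum`
(`p_1, …, p_n` algebraically independent; Goodman–Wallach §5.1.3 Ex. 4).
[cite: GoodmanWallachGTM255, §5.1.3 Exercise 4] -/
theorem blockPsumAeval_injective_of_subsingleton [Subsingleton T] (τ₀ : T) :
    Function.Injective (blockPsumAeval T n ℂ) := by
  classical
  haveI : Unique T := uniqueOfSubsingleton τ₀
  set e : T × Fin n ≃ Fin n := Equiv.uniqueProd (Fin n) T with he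
  -- `rename e ∘ blockPsumAeval = (aeval p_{·+1}) ∘ rename e`
  have hcomm : ∀ G : MvPolynomial (T × Fin n) ℂ,
      rename e (blockPsumAeval T n ℂ G) =
        aeval (fun i : Fin n => psum (Fin n) ℂ ((i : ℕ) + 1)) (rename e G) := by
    intro G
    change ((rename e).comp (blockPsumAeval T n ℂ)) G =
      ((aeval fun i : Fin n => psum (Fin n) ℂ ((i : ℕ) + 1)).comp (rename e)) G
    congr 1
    refine MvPolynomial.algHom_ext fun p => ?_
    rw [AlgHom.comp_apply, AlgHom.comp_apply, rename_X, aeval_X, blockPsumAeval, aeval_X, bpsum,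
      rename_rename]
    have hep : e p = p.2 := Equiv.uniqueProd_apply _
    have hcomp : (e : T × Fin n → Fin n) ∘ Prod.mk p.1 = id := by
      funext i
      exact Equiv.uniqueProd_apply _
    rw [hcomp, rename_id, AlgHom.id_apply, hep]
  have hψ : Function.Injective (aeval fun i : Fin n => psum (Fin n) ℂ ((i : ℕ) + 1)) :=
    algebraicIndependent_iff_injective_aeval.1
      (Literature.RepresentationTheory.ClassicalInvariants.PowerSumBasicInvariants.algebraicIndependent_psum
        (K := ℂ) n)
  intro G₁ G₂ h
  have h' := congr_arg (rename e) h
  rw [hcomm, hcomm] at h'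
  exact rename_injective e e.injective (hψ h')

omit [Fintype T] [DecidableEq T] in
/-- The block power sum `p_p(x_{τ,·}) = Σ_i x_{τ,i}^p` is nonzero for `n ≥ 1` (its value at the
point `x ≡ 1` is `n ≠ 0`). [folklore] -/
private theorem bpsum_ne_zero (hn : 0 < n) (τ : T) (p : ℕ) : bpsum (n := n) ℂ τ p ≠ 0 := by
  intro h
  have he := congr_arg (MvPolynomial.eval fun _ : T × Fin n => (1 : ℂ)) h
  rw [bpsum, eval_rename, psum, map_sum, map_zero] at he
  simp only [Function.comp_def, map_pow, eval_X, one_pow, Finset.sum_const, Finset.card_univ,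
    Fintype.card_fin, nsmul_eq_mul, mul_one] at he
  exact (Nat.cast_ne_zero.2 hn.ne') he

/-- **The length of the Casimir element `C_p` is exactly `p`**: `C_p ∈ U(𝔤)_{≤p}`
(`HCCore.casimir_mem_fil`) and `C_p ∉ U(𝔤)_{≤m}` for `m < p` (`n ≥ 1`), because the `p`-th symbol
of `C_p` restricts on the diagonal to the power sum `p_p(x_{τ,·}) ≠ 0` (`HCCore.symb_casimir`,
`HCCore.restrictDiag_trace_genMat_pow`) while `U(𝔤)_{≤m}` has vanishing `p`-th symbol — "The
lengths of these elements coincide with the degrees of the fundamental invariants […] the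
elementary symmetric polynomials, which have degrees `1, …, k`. These numbers give lengths of
Casimir elements generating the center".
[cite: BergEtAl2024, Thm. 4.13, p.20–21 (PDF pp.21–22)] locator: paper:arxiv-2411.03444 p0021.txt:L51–L60, p0022.txt:L1 -/
theorem casimir_not_mem_fil (hn : 0 < n) (τ : T) {p m : ℕ} (hm : m < p) :
    casimir n τ p ∉ fil (stdB T n) m := by
  intro hmem
  have h0 := symb_eq_zero_of_mem_fil (stdB T n) hm hmem
  rw [symb_casimir] at h0
  have h1 := congr_arg (restrictDiag T n ℂ) h0
  rw [restrictDiag_trace_genMat_pow, map_zero] at h1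
  exact bpsum_ne_zero hn τ p h1

/-- The length of `C_p` is exactly `p`: `C_p ∈ U(𝔤)_{≤p} ∖ U(𝔤)_{≤(p−1)}` (`1 ≤ p`, `n ≥ 1`).
[cite: BergEtAl2024, Thm. 4.13, p.20–21 (PDF pp.21–22)] locator: paper:arxiv-2411.03444 p0021.txt:L51–L60, p0022.txt:L1 -/
theorem casimir_mem_fil_and_not_mem (hn : 0 < n) (τ : T) {p : ℕ} (hp : 1 ≤ p) :
    casimir n τ p ∈ fil (stdB T n) p ∧ casimir n τ p ∉ fil (stdB T n) (p - 1) :=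
  ⟨casimir_mem_fil τ p, casimir_not_mem_fil hn τ (by omega)⟩

end Independence

/-! ### [BDGIL24, Thm. 4.13] for `gl_k`: one block `T₀ = (ℝ →ₐ[ℝ] ℂ)` -/

section GLk

variable {k : ℕ}

/-- The index type of the Casimir generators in the one-block model has `k` elements (`dim 𝔥 = k`
generators): `T₀ = (ℝ →ₐ[ℝ] ℂ)` is a one-element type (Mathlib `Algebra.subsingleton_id`).
[cite: BergEtAl2024, Thm. 4.13, p.20 (PDF p.21)] locator: paper:arxiv-2411.03444 p0021.txt:L48–L51 -/
theorem card_casimirIndex : Fintype.card ((ℝ →ₐ[ℝ] ℂ) × Fin k) = k := by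
  haveI : Unique (ℝ →ₐ[ℝ] ℂ) := uniqueOfSubsingleton (Algebra.ofId ℝ ℂ)
  rw [Fintype.card_prod, Fintype.card_unique, Fintype.card_fin, one_mul]

/-- **[BDGIL24, Thm. 4.13] for `gl_k` — generation: `Z(gl_k) = ℂ[C_1, …, C_k]`.** Every central
element of `U(gl_k)` (block model `U(T₀ → gl_k)`, `T₀ = (ℝ →ₐ[ℝ] ℂ)` one block, where the tree's
Harish-Chandra isomorphism `HarishChandraHomGL.complexified_injective_and_range_eq` lives) is a
polynomial in the Casimir elements (8) `C_{p+1} = tr(𝔼^{p+1})`, `p < k`: `HCCore.zOfPoly` is onto the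
centre. [cite: BergEtAl2024, Thm. 4.13, p.20 (PDF p.21)] locator: paper:arxiv-2411.03444 p0021.txt:L48–L53
[cite: Humphreys1972, §23.3] -/
theorem zOfPoly_surjective [DecidableEq (ℝ →ₐ[ℝ] ℂ)] :
    Function.Surjective (zOfPoly (ℝ →ₐ[ℝ] ℂ) k) :=
  zOfPoly_surjective_of_hasHWProperty (harishChandraHomGL ℝ k).hasHWProperty_complexified
    (harishChandraHomGL ℝ k).complexified_mem
    (harishChandraHomGL ℝ k).complexified_injective_and_range_eq.1

/-- In the centre: the Casimir elements generate everything, `ℂ[C_{τ,p+1}] = Z(gl_k)` (`⊤` of the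
centre subalgebra). [cite: BergEtAl2024, Thm. 4.13, p.20 (PDF p.21)] locator: paper:arxiv-2411.03444 p0021.txt:L48–L53 -/
theorem adjoin_casimirC_eq_top [DecidableEq (ℝ →ₐ[ℝ] ℂ)] :
    Algebra.adjoin ℂ (Set.range (casimirC (ℝ →ₐ[ℝ] ℂ) k)) = ⊤ := by
  rw [← MvPolynomial.aeval_range, eq_top_iff]
  rintro z -
  exact zOfPoly_surjective z

/-- **`Z(gl_k) = ℂ[C_1, …, C_k]` as subalgebras of `U(gl_k)`**: the centre is the subalgebra
generated by the Casimir elements (8) (block model, `T₀ = (ℝ →ₐ[ℝ] ℂ)`).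
[cite: BergEtAl2024, Thm. 4.13 and eq. (8), p.20–21 (PDF pp.21–22)] locator: paper:arxiv-2411.03444 p0021.txt:L48–L53, p0022.txt:L1–L6 -/
theorem center_eq_adjoin_casimir [DecidableEq (ℝ →ₐ[ℝ] ℂ)] :
    Subalgebra.center ℂ (UniversalEnvelopingAlgebra ℂ ((ℝ →ₐ[ℝ] ℂ) → Matrix (Fin k) (Fin k) ℂ)) =
      Algebra.adjoin ℂ (Set.range fun p : (ℝ →ₐ[ℝ] ℂ) × Fin k =>
        (casimir k p.1 ((p.2 : ℕ) + 1) :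
          UniversalEnvelopingAlgebra ℂ ((ℝ →ₐ[ℝ] ℂ) → Matrix (Fin k) (Fin k) ℂ))) := by
  -- the generators of `U` are the images of the generators `casimirC` of the centre
  have hset : (Set.range fun p : (ℝ →ₐ[ℝ] ℂ) × Fin k =>
      (casimir k p.1 ((p.2 : ℕ) + 1) :
        UniversalEnvelopingAlgebra ℂ ((ℝ →ₐ[ℝ] ℂ) → Matrix (Fin k) (Fin k) ℂ))) =
      (Subalgebra.center ℂ _).val '' Set.range (casimirC (ℝ →ₐ[ℝ] ℂ) k) := by
    rw [← Set.range_comp]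
    rfl
  rw [hset, ← AlgHom.map_adjoin, adjoin_casimirC_eq_top, Algebra.map_top, Subalgebra.range_val]

/-- **[BDGIL24, Thm. 4.13] for `gl_k` — algebraic independence: the Casimir elements (8)
`C_1, …, C_k` are algebraically independent** (as elements of the commutative algebra `Z(gl_k)`,
where algebraic independence makes sense: `HCCore.casimirC (τ, p) = C_{p+1}`; block model,
`T₀ = (ℝ →ₐ[ℝ] ℂ)`): top symbols reduce it to the algebraic independence of the power sums
`p_1, …, p_k` (`zOfPoly_injective_of_blockPsumAeval_injective`, `blockPsumAeval_injective_of_subsingleton`).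
[cite: BergEtAl2024, Thm. 4.13, p.20 (PDF p.21)] locator: paper:arxiv-2411.03444 p0021.txt:L48–L51
[cite: GoodmanWallachGTM255, §5.1.3 Exercise 4] -/
theorem algebraicIndependent_casimirC [DecidableEq (ℝ →ₐ[ℝ] ℂ)] :
    AlgebraicIndependent ℂ (casimirC (ℝ →ₐ[ℝ] ℂ) k) := by
  rw [algebraicIndependent_iff_injective_aeval]
  exact zOfPoly_injective_of_blockPsumAeval_injective
    (blockPsumAeval_injective_of_subsingleton (Algebra.ofId ℝ ℂ))

/-- **[BDGIL24, Thm. 4.13] (Harish-Chandra isomorphism) for `gl_k`, as printed**: "there exist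
algebraically independent `C_1, …, C_k ∈ U(𝔤)` such that `Z(𝔤) = ℂ[C_1, …, C_k]`. The lengths of
these elements coincide with the degrees of the fundamental invariants […] `1, …, k`", with the
Casimir elements (8) `C_p = Σ E_{i_1 i_2} ⋯ E_{i_p i_1} = tr(𝔼^p)` (`HCCore.casimir`; as elements of the
centre `HCCore.casimirC`): in the block model `U(T₀ → gl_k)`, `T₀ = (ℝ →ₐ[ℝ] ℂ)` a ONE-element type
(so the `k` generators are indexed by `T₀ × Fin k`, `card_casimirIndex`), the `C_{p+1}`, `p < k`, are
algebraically independent (`algebraicIndependent_casimirC`, in the commutative algebra `Z(𝔤)`),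
generate the centre (`center_eq_adjoin_casimir`), and `C_{p+1}` has length exactly `p + 1`:
`C_{p+1} ∈ U(𝔤)_{≤ p+1} ∖ U(𝔤)_{≤ p}` ("length", §4.3 = the tree's `Literature.Algebra.Lie.PBW.fil`;
`HCCore.casimir_mem_fil`, `casimir_not_mem_fil`). The first clause `Z(𝔤) ≅ U(𝔥)^{W}` (symmetric
polynomials) is the tree's `HarishChandraHomGL.complexified_injective_and_range_eq`
(`symmetricSubalgebraGL_eq_blockSymmetricSubalgebra`) and is not restated.
[cite: BergEtAl2024, Thm. 4.13 and eq. (8), p.20–21 (PDF pp.21–22)] locator: paper:arxiv-2411.03444 p0021.txt:L48–L60, p0022.txt:L1–L6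
[cite: Humphreys1972, §23.3] -/
theorem thm_4_13 [DecidableEq (ℝ →ₐ[ℝ] ℂ)] :
    AlgebraicIndependent ℂ (casimirC (ℝ →ₐ[ℝ] ℂ) k) ∧
      Subalgebra.center ℂ (UniversalEnvelopingAlgebra ℂ ((ℝ →ₐ[ℝ] ℂ) → Matrix (Fin k) (Fin k) ℂ)) =
        Algebra.adjoin ℂ (Set.range fun p : (ℝ →ₐ[ℝ] ℂ) × Fin k =>
          (casimir k p.1 ((p.2 : ℕ) + 1) :
            UniversalEnvelopingAlgebra ℂ ((ℝ →ₐ[ℝ] ℂ) → Matrix (Fin k) (Fin k) ℂ))) ∧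
      ∀ p : (ℝ →ₐ[ℝ] ℂ) × Fin k,
        casimir k p.1 ((p.2 : ℕ) + 1) ∈ fil (stdB (ℝ →ₐ[ℝ] ℂ) k) ((p.2 : ℕ) + 1) ∧
          casimir k p.1 ((p.2 : ℕ) + 1) ∉ fil (stdB (ℝ →ₐ[ℝ] ℂ) k) (p.2 : ℕ) :=
  ⟨algebraicIndependent_casimirC, center_eq_adjoin_casimir, fun p =>
    ⟨casimir_mem_fil p.1 _, casimir_not_mem_fil (Fin.pos p.2) p.1 (Nat.lt_succ_self _)⟩⟩

end GLk


end BergEtAl2024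

end Literature.Barriers.ValiantsHypothesis
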